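import Mathlib
import Summits.Langlands.Langlands.Theses.QuadraticWindow
import Literature.NumberTheory.Automorphic.AutomorphicTwistBJ
import Literature.NumberTheory.Automorphic.AutomorphicTwistWeightOne
import Literature.NumberTheory.Automorphic.StrongMultiplicityOneSphericalProofs
import Literature.NumberTheory.Automorphic.ReciprocityGLnRestrictionProofs
import Literature.NumberTheory.GaloisRepresentations.IntegralGaloisActionProofs
import Literature.NumberTheory.GaloisRepresentations.HeckeCharacterGaloisAvatarProofs
import Summits.Langlands.Langlands.Theorems.QuadraticWindowTwistNormalizationSeparating
import Summits.Langlands.Langlands.Theorems.QuadraticWindowHostInducedRepInducedPackageAux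

/-!
# Support for `TwistNormalization` (route `QuadraticWindow`, stmt-Langlands-10904), V:
# the twisted datum `π ⊗ (μ ∘ det)`

For a cuspidal `π` on `GL_n/F` and a finite-order Hecke character `μ` of `F` with Galois avatar
character `E : Γ_F → ℂˣ` (`E(Frob_w) = μ(ϖ_w)` almost everywhere):

* `twist_isUnramifiedAt` — `π ⊗ μ` is unramified wherever `π` and `μ` are (Satake parameter
  `μ(ϖ_w) · t_{π,w}` at a level of `μ ∘ det` prime to `w`; Arthur–Clozel 1989, Ch. 3, p. 172;
  `hasSatakeParamAt_twist_at_unramified_place` of `QuadraticWindowHostInducedRepInducedPackageAux`);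
* `twist_isRegularAlgebraic` — `π ⊗ μ` is regular algebraic if `π` is (the archimedean parameter is
  unchanged, `AutomorphicRepData.HasArchParameter.twist`);
* `twisted_polarization` — if `π` is `τ`-polarized a.e. with respect to `(e, k)` then `π ⊗ μ` is
  `τ`-polarized a.e. with respect to `(e ⊗ δ, k)` for any character `δ` of `Γ_{F₀}` restricting to
  `E · (E ∘ θ_t)` on `Γ_F` (`t` a lift of `τ`): `Sat(π⊗μ, τw) = μ(ϖ_{τw}) Sat(π, τw)` and
  `δ(Frob_v)^{f(w|v)} = μ(ϖ_w) μ(ϖ_{τw})`.  (Arthur–Clozel 1989 Ch. 3 §6; BLGGT arXiv:1010.2561 §2.1: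
  `(π ⊗ μ)^τ ≅ (π ⊗ μ)^∨ ⊗ μμ^τ η∘N`.)
-/

set_option linter.dupNamespace false -- project-wide option (lakefile weak.linter.dupNamespace); `Summit.Langlands.Langlands` is the mandated namespace

noncomputable section

open Literature.NumberTheory.GaloisRepresentations Literature.NumberTheory.Automorphic
open Field IsDedekindDomain NumberField Polynomial Filter
open scoped MatrixGroups Topology Classical

namespace Summit.Langlands.Langlands.Theorems.TwistNormalization

/-! ## Unramifiedness and regularity of the twist -/

section Level

variable {n : ℕ} {K : Type} [Field K] [NumberField K]

/-- `π ⊗ χ` is unramified at every place where `π` and `χ` are. [folklore] -/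
theorem twist_isUnramifiedAt {hcpt : isCompact_glFiniteIntegralLevel n K}
    {π : AutomorphicRepData (AutomorphyDatum.gl n K hcpt)} {v : HeightOneSpectrum (𝓞 K)}
    (h : π.IsUnramifiedAt v) {χ : HeckeCharacter K} (hχ : χ.IsFiniteOrder) (hv : χ.IsUnramifiedAt v) :
    (π.twist χ hχ).IsUnramifiedAt v := by
  obtain ⟨α, hα⟩ := h
  exact ⟨_, HostInducedRep.GrsExplicitDescent.hasSatakeParamAt_twist_at_unramified_place hα hχ hv⟩

/-- `π ⊗ χ` is regular algebraic if `π` is: the archimedean parameter is unchanged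
(`AutomorphicRepData.HasArchParameter.twist`; Clozel 1990, §3.3). [folklore] -/
theorem twist_isRegularAlgebraic {hcpt : isCompact_glFiniteIntegralLevel n K}
    {π : AutomorphicRepData (AutomorphyDatum.gl n K hcpt)} (h : π.IsRegularAlgebraic)
    (χ : HeckeCharacter K) (hχ : χ.IsFiniteOrder) : (π.twist χ hχ).IsRegularAlgebraic := by
  obtain ⟨T, ⟨hwf, harch⟩, hreg⟩ := h
  exact ⟨T, ⟨hwf, AutomorphicRepData.HasArchParameter.twist π χ hχ harch⟩, hreg⟩

end Level

/-! ## The twisted polarization -/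

section Polarization

variable {F₀ F : Type} [Field F₀] [NumberField F₀] [Field F] [NumberField F] [Algebra F₀ F]

/-- **`π ⊗ μ` is `τ`-polarized with respect to `(e ⊗ δ, k)`.**  Let `[F:F₀] = 2` with non-trivial
automorphism `τ` and lift `t ∈ Γ_{F₀}`; `π` an automorphic representation of `GL_n(𝔸_F)` which is
`τ`-polarized a.e. with respect to the rank-one avatar `e : Γ_{F₀} → GL_1(ℂ)` and `k : ℤ` (the
hypothesis `hpol` of the route, verbatim); `μ` a finite-order Hecke character of `F` with a
character `E : Γ_F → ℂˣ` such that `E(Φ) = μ(ϖ_w)` for the Frobenii `Φ` above almost every `w`;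
`δ : Γ_{F₀} → ℂˣ` a character with `δ(res σ) = E(σ) E(θ_t σ)`, and `det e · δ` with open kernel.
Then `π ⊗ (μ ∘ det)` is `τ`-polarized a.e. with respect to the rank-one avatar of `det e · δ` and
the same `k`.  Arthur–Clozel 1989, Ch. 3 §6; Barnet-Lamb–Gee–Geraghty–Taylor (arXiv:1010.2561)
§2.1. -/
theorem twisted_polarization (hdeg : Module.finrank F₀ F = 2) {τ : F ≃ₐ[F₀] F}
    {t : absoluteGaloisGroup F₀}
    (ht : haveI := isGalois_of_finrank_eq_two hdeg; absGaloisQuot F₀ F t = τ)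
    {n : ℕ} {hcpt : isCompact_glFiniteIntegralLevel n F}
    (π : AutomorphicRepData (AutomorphyDatum.gl n F hcpt)) (e : FramedGaloisRep F₀ ℂ 1) (k : ℤ)
    (hpol : ∀ᶠ w in Filter.cofinite, ∀ (α β : Multiset ℂ) (c : ℂ), π.HasSatakeParamAt w α →
      π.HasSatakeParamAt (τ • w) β → e.HasFrobCharpolyAt (w.under (𝓞 F₀)) (X - C c) →
      β = α.map (fun a ↦ a⁻¹ * (c * ((w.under (𝓞 F₀)).residueCard : ℂ) ^ k) ^
        w.asIdeal.inertiaDeg (𝓞 F₀)))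
    (μ : HeckeCharacter F) (hμ : μ.IsFiniteOrder) (E : absoluteGaloisGroup F →* ℂˣ)
    (hE : ∀ᶠ w : HeightOneSpectrum (𝓞 F) in cofinite, ∀ 𝔓 ∈ w.primesAbove,
      ∀ Φ : absoluteGaloisGroup F, IsArithFrobAt (𝓞 F) Φ 𝔓 → ((E Φ : ℂˣ) : ℂ) = μ.valueAtUniformizer w)
    (δ : absoluteGaloisGroup F₀ →* ℂˣ)
    (hδ : haveI := isGalois_of_finrank_eq_two hdeg;
      ∀ σ, δ (absGaloisRestrict F₀ F σ) = E σ * E (absGaloisOuterConj F₀ F t σ))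
    (hopen : IsOpen ((((FramedRep.det e).toMonoidHom * δ).ker : Subgroup (absoluteGaloisGroup F₀)) :
      Set (absoluteGaloisGroup F₀))) :
    ∀ᶠ w in Filter.cofinite, ∀ (α β : Multiset ℂ) (c : ℂ), (π.twist μ hμ).HasSatakeParamAt w α →
      (π.twist μ hμ).HasSatakeParamAt (τ • w) β →
      (FramedGaloisRep.ofOpenKer ((FramedRep.det e).toMonoidHom * δ) hopen).HasFrobCharpolyAt
        (w.under (𝓞 F₀)) (X - C c) →
      β = α.map (fun a ↦ a⁻¹ * (c * ((w.under (𝓞 F₀)).residueCard : ℂ) ^ k) ^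
        w.asIdeal.inertiaDeg (𝓞 F₀)) := by
  haveI := isGalois_of_finrank_eq_two hdeg
  set e' := FramedGaloisRep.ofOpenKer ((FramedRep.det e).toMonoidHom * δ) hopen with he'
  -- the cofinite good set
  have hτinj : Function.Injective fun w : HeightOneSpectrum (𝓞 F) => τ • w := MulAction.injective τ
  have g1 : ∀ᶠ w : HeightOneSpectrum (𝓞 F) in cofinite, π.IsUnramifiedAt w :=
    π.hasSatakeParamAt_cofinite_holds
  have g2 : ∀ᶠ w : HeightOneSpectrum (𝓞 F) in cofinite, π.IsUnramifiedAt (τ • w) :=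
    hτinj.tendsto_cofinite.eventually g1
  have g3 := π.eventually_hasSatakeParamAt_twist hμ
  have g4 : ∀ᶠ w : HeightOneSpectrum (𝓞 F) in cofinite, ∀ α, π.HasSatakeParamAt (τ • w) α →
      (π.twist μ hμ).HasSatakeParamAt (τ • w) (α.map (μ.valueAtUniformizer (τ • w) * ·)) :=
    hτinj.tendsto_cofinite.eventually g3
  have g5 : ∀ᶠ w : HeightOneSpectrum (𝓞 F) in cofinite, ∀ 𝔓 ∈ (τ • w).primesAbove,
      ∀ Φ : absoluteGaloisGroup F, IsArithFrobAt (𝓞 F) Φ 𝔓 →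
        ((E Φ : ℂˣ) : ℂ) = μ.valueAtUniformizer (τ • w) :=
    hτinj.tendsto_cofinite.eventually hE
  have g6 : ∀ᶠ w : HeightOneSpectrum (𝓞 F) in cofinite, e.IsUnramifiedAt (w.under (𝓞 F₀)) :=
    (HeightOneSpectrum.tendsto_under_cofinite (𝓞 F₀) (B := 𝓞 F)).eventually
      (FramedArtinRep.eventually_isUnramifiedAt e)
  filter_upwards [g1, g2, g3, g4, hE, g5, g6, hpol] with w hw1 hw2 hw3 hw4 hw5 hw6 hw7 hw8
  intro α' β' c' hα' hβ' hc'
  -- Satake parameters of `π` at `w`, `τ • w` and of the twist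
  obtain ⟨α, hα⟩ := hw1
  obtain ⟨β, hβ⟩ := hw2
  set m := μ.valueAtUniformizer w with hm
  set m' := μ.valueAtUniformizer (τ • w) with hm'
  have hα'eq : α' = α.map (m * ·) := (π.twist μ hμ).hasSatakeParamAt_unique_holds hα' (hw3 α hα)
  have hβ'eq : β' = β.map (m' * ·) := (π.twist μ hμ).hasSatakeParamAt_unique_holds hβ' (hw4 β hβ)
  -- the Frobenius value `c` of `e` at `v = w ∩ F₀`, and `hpol`
  set v := w.under (𝓞 F₀) with hv
  obtain ⟨c, hc⟩ := exists_hasFrobCharpolyAt_of_isUnramifiedAt_rankOne hw7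
  have hpolw := hw8 α β c hα hβ hc
  -- restriction to `Γ_F`: values `c ^ f` and `c' ^ f` at the Frobenii above `w`
  set f := w.asIdeal.inertiaDeg (𝓞 F₀) with hf
  have hwv : w.asIdeal.under (𝓞 F₀) = v.asIdeal := (HeightOneSpectrum.under_asIdeal (𝓞 F₀) w).symm
  have hres : ∀ {ρ : FramedGaloisRep F₀ ℂ 1} {a : ℂ}, ρ.HasFrobCharpolyAt v (X - C a) →
      ∀ 𝔓 ∈ w.primesAbove, ∀ Φ : absoluteGaloisGroup F, IsArithFrobAt (𝓞 F) Φ 𝔓 →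
        ((FramedRep.det ρ (absGaloisRestrict F₀ F Φ) : ℂˣ) : ℂ) = a ^ f := by
    intro ρ a ha 𝔓 h𝔓 Φ hΦ
    have h1 := ρ.hasFrobCharpolyAt_restrictField (E := F) hwv (isUnramifiedAt_of_hasFrobCharpolyAt_rankOne ha)
      (s := {a}) (by simpa using ha)
    simp only [Multiset.map_singleton, Multiset.prod_singleton] at h1
    rw [hasFrobCharpolyAt_iff_det] at h1
    have h2 := h1 𝔓 h𝔓 Φ hΦ
    rwa [FramedRep.det_apply, FramedGaloisRep.restrictField_apply, ← FramedRep.det_apply] at h2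
  obtain ⟨𝔓, h𝔓⟩ := w.primesAbove_nonempty
  obtain ⟨Φ, hΦ⟩ := HeightOneSpectrum.exists_isArithFrobAt_of_mem_primesAbove_holds h𝔓
  have hcf : ((FramedRep.det e (absGaloisRestrict F₀ F Φ) : ℂˣ) : ℂ) = c ^ f := hres hc 𝔓 h𝔓 Φ hΦ
  have hc'f : ((FramedRep.det e' (absGaloisRestrict F₀ F Φ) : ℂˣ) : ℂ) = c' ^ f := hres hc' 𝔓 h𝔓 Φ hΦ
  -- `det e' = det e · δ` and `δ(res Φ) = E(Φ) E(θ_t Φ) = m m'`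
  have hdet' : ∀ g, ((FramedRep.det e' g : ℂˣ) : ℂ) = ((FramedRep.det e g : ℂˣ) : ℂ) * ((δ g : ℂˣ) : ℂ) := by
    intro g
    rw [FramedRep.det_apply, Matrix.GeneralLinearGroup.val_det_apply, Matrix.det_fin_one, he',
      FramedGaloisRep.ofOpenKer_apply_coe, MonoidHom.mul_apply, Units.val_mul, FramedRep.det_apply]
    rfl
  have hEΦ : ((E Φ : ℂˣ) : ℂ) = m := hw5 𝔓 h𝔓 Φ hΦ
  have hEΦ' : ((E (absGaloisOuterConj F₀ F t Φ) : ℂˣ) : ℂ) = m' := by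
    have h := hw6 (outerConjIdeal t 𝔓) (by rw [← ht]; exact outerConjIdeal_mem_primesAbove h𝔓 t) _
      ((isArithFrobAt_absGaloisOuterConj_iff h𝔓 t Φ).mpr hΦ)
    exact h
  have key : c' ^ f = c ^ f * (m * m') := by
    rw [← hc'f, hdet', hcf, hδ, Units.val_mul, hEΦ, hEΦ']
  -- nonvanishing
  have hm0 : m ≠ 0 := by rw [← hEΦ]; exact Units.ne_zero _
  -- the multiset identity
  rw [hβ'eq, hpolw, hα'eq, Multiset.map_map, Multiset.map_map]
  refine Multiset.map_congr rfl fun a _ => ?_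
  simp only [Function.comp_apply]
  rw [mul_pow, mul_pow, key, mul_inv]
  field_simp

end Polarization

end Summit.Langlands.Langlands.Theorems.TwistNormalization

end
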